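import Mathlib

/-!
# T5ClearingDenominators — the span over a lattice equals the span over its rational hull
(N1 §ID-2(c), «clearing denominators in φ»)

Sub-step N1 of Tier 5 (route/T5-ID-p2.md, §ID-2(c), left inclusion) passes from the
`ℂ`-span of the pull-backs `φ^* α_i` over `φ ∈ Hom_E(A_K, A_{μ_i})_ℚ` (Liu Thm. 4.18(1) is
stated for the `ℚ`-vector space) to the span over the lattice `Hom_E(A_K, A_{μ_i})` with the
words «clearing denominators in φ». This file records that step: for a `ℚ`-vector space `U`
and an additive subgroup `M ⊆ U` that is *full* (every vector of `U` has a non-zero natural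
multiple in `M` — the shape of `M ⊆ M ⊗ ℚ`), and any `ℚ`-linear map `ψ` from `U` to a
`ℂ`-vector space, the `ℂ`-span of `ψ(M)` is the `ℂ`-span of `ψ(U)`:

* `span_image_eq_of_isFull` — `span_ℂ (ψ '' M) = span_ℂ (range ψ)`;
* `mem_span_image_of_isFull`, `smul_mem_span_image` — the one-line facts behind it;
* `isFull_map` — fullness is preserved by surjective `ℚ`-linear maps;
* `isFull_top` — the whole space is full.

Nothing about abelian varieties or homomorphism groups is formalised: `U` is any `ℚ`-space,
`M` any additive subgroup, `W` any `ℂ`-space whose `ℚ`-structure is the restricted one.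
-/

namespace Summit.Ventures.HodgeRepro2.T5ClearingDenominators

variable {U : Type*} [AddCommGroup U] [Module ℚ U]
variable {W : Type*} [AddCommGroup W] [Module ℚ W] [Module ℂ W] [IsScalarTower ℚ ℂ W]

/-- An additive subgroup `M` of a `ℚ`-vector space `U` is *full* when every vector of `U` has a
non-zero natural multiple in `M` — the shape of the lattice `Hom_E(A_K, A_μ)` inside
`Hom_E(A_K, A_μ)_ℚ = Hom_E(A_K, A_μ) ⊗ ℚ`. -/
def IsFull (M : AddSubgroup U) : Prop :=
  ∀ u : U, ∃ n : ℕ, n ≠ 0 ∧ (n : ℚ) • u ∈ M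

/-- The whole space is full. -/
theorem isFull_top : IsFull (⊤ : AddSubgroup U) :=
  fun _ => ⟨1, one_ne_zero, AddSubgroup.mem_top _⟩

/-- A rational scalar acts on the `ℂ`-space `W` through `algebraMap ℚ ℂ`. -/
theorem rat_smul_eq_algebraMap_smul (r : ℚ) (w : W) : r • w = (algebraMap ℚ ℂ r) • w :=
  (IsScalarTower.algebraMap_smul ℂ r w).symm

/-- If `(n : ℚ) • u ∈ M` with `n ≠ 0`, then `ψ u` lies in the `ℂ`-span of `ψ(M)`. -/
theorem smul_mem_span_image (M : AddSubgroup U) (ψ : U →ₗ[ℚ] W) {u : U} {n : ℕ} (hn : n ≠ 0)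
    (hu : (n : ℚ) • u ∈ M) : ψ u ∈ Submodule.span ℂ (ψ '' (M : Set U)) := by
  have hn' : (n : ℚ) ≠ 0 := by exact_mod_cast hn
  have : ψ u = ((n : ℚ)⁻¹) • ψ ((n : ℚ) • u) := by
    rw [map_smul, smul_smul, inv_mul_cancel₀ hn', one_smul]
  rw [this, rat_smul_eq_algebraMap_smul]
  exact Submodule.smul_mem _ _ (Submodule.subset_span ⟨(n : ℚ) • u, hu, rfl⟩)

/-- For a full `M`, every `ψ u` lies in the `ℂ`-span of `ψ(M)`. -/
theorem mem_span_image_of_isFull (M : AddSubgroup U) (hM : IsFull M) (ψ : U →ₗ[ℚ] W) (u : U) :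
    ψ u ∈ Submodule.span ℂ (ψ '' (M : Set U)) := by
  obtain ⟨n, hn, hu⟩ := hM u
  exact smul_mem_span_image M ψ hn hu

/-- **Clearing denominators.** For a full additive subgroup `M` of the `ℚ`-space `U` and a
`ℚ`-linear map `ψ : U → W` into a `ℂ`-space, the `ℂ`-span of `ψ(M)` equals the `ℂ`-span of the
whole image `ψ(U)`. -/
theorem span_image_eq_of_isFull (M : AddSubgroup U) (hM : IsFull M) (ψ : U →ₗ[ℚ] W) :
    Submodule.span ℂ (ψ '' (M : Set U)) = Submodule.span ℂ (Set.range ψ) := by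
  refine le_antisymm (Submodule.span_mono (Set.image_subset_range ψ _)) ?_
  rw [Submodule.span_le]
  rintro _ ⟨u, rfl⟩
  exact mem_span_image_of_isFull M hM ψ u

/-- The span form used in §ID-2(c): a family of vectors indexed by `U` through `ψ`, restricted
to `M`, spans the same `ℂ`-subspace as the family over all of `U`. -/
theorem span_setOf_eq_of_isFull (M : AddSubgroup U) (hM : IsFull M) (ψ : U →ₗ[ℚ] W) :
    Submodule.span ℂ {w | ∃ φ ∈ M, ψ φ = w} = Submodule.span ℂ {w | ∃ φ : U, ψ φ = w} := by
  have h1 : {w | ∃ φ ∈ M, ψ φ = w} = ψ '' (M : Set U) := by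
    ext w; simp only [Set.mem_setOf_eq, Set.mem_image, SetLike.mem_coe]
  have h2 : {w | ∃ φ : U, ψ φ = w} = Set.range ψ := by
    ext w; simp only [Set.mem_setOf_eq, Set.mem_range]
  rw [h1, h2]
  exact span_image_eq_of_isFull M hM ψ

/-- Fullness is preserved by surjective `ℚ`-linear maps. -/
theorem isFull_map {U' : Type*} [AddCommGroup U'] [Module ℚ U'] (M : AddSubgroup U)
    (hM : IsFull M) (f : U →ₗ[ℚ] U') (hf : Function.Surjective f) :
    IsFull (M.map f.toAddMonoidHom) := by
  intro u'
  obtain ⟨u, rfl⟩ := hf u'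
  obtain ⟨n, hn, hu⟩ := hM u
  refine ⟨n, hn, ?_⟩
  rw [← map_smul]
  exact AddSubgroup.mem_map_of_mem _ hu

/-- Fullness passes to the image under a `ℚ`-linear map, as a statement about spans: the
`ℂ`-span of `ψ ∘ f` over `M` is the `ℂ`-span of `ψ` over `f(U)`... specialised: over all of
`U'` when `f` is surjective. -/
theorem span_image_comp_eq_of_isFull {U' : Type*} [AddCommGroup U'] [Module ℚ U']
    (M : AddSubgroup U) (hM : IsFull M) (f : U →ₗ[ℚ] U') (hf : Function.Surjective f)
    (ψ : U' →ₗ[ℚ] W) :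
    Submodule.span ℂ ((ψ ∘ₗ f) '' (M : Set U)) = Submodule.span ℂ (Set.range ψ) := by
  rw [span_image_eq_of_isFull M hM (ψ ∘ₗ f)]
  congr 1
  ext w
  constructor
  · rintro ⟨u, rfl⟩
    exact ⟨f u, rfl⟩
  · rintro ⟨u', rfl⟩
    obtain ⟨u, rfl⟩ := hf u'
    exact ⟨u, rfl⟩

end Summit.Ventures.HodgeRepro2.T5ClearingDenominators
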